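import Summits.KontsevichZagierPeriods.KontsevichZagierPeriods.Theorems.OctahedralSymmetryOctahedralSpanAllWeightsStubRegularUnitManyTwos
import Mathlib.LinearAlgebra.Span.Basic
import HarnessLib

/-!
# Crux `OctahedralSpanAllWeights` (stmt-KontsevichZagierPeriods-9659), line `Sketch`:
# the σ-inclusion–exclusion over the FULL alphabet — majority-`2` words reduce, in every weight

**Theorem `majorityTwos` (all weights).** Every convergent level-4 word `V` (letters `Fin 5`: `0..3` = poles
`i^m`, `4` = pole `0`) in which the letter `2` (pole `−1`) occupies a STRICT MAJORITY of the positions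
(`|V| < 2 · #2(V)`) lies, modulo the relation module `rel`, in the span of the convergent words of the same
length with FEWER letters `2`. Only involution generators are used (Zhao's `σ(t) = (1−t)/(1+t)`), and only
those of words with fewer letters `2` than `V`. This generalises `unit_manyTwos` (file …ManyTwos, unit words)
from the alphabet `{1,2,3}` to all five letters: under `σ` EVERY letter `a ≠ 2` expands as
`[partner a] − [2]` (`partner`: `0 ↔ 4`, `1 ↔ 3`) and `2 ↦ −[2]`, so the subset expansion
`sigmaSubst U = Σ_{T ⊆ S(U)} (−1)^{|T|} [reverse(partner U on T, 2 elsewhere)]` and the inclusion–exclusion of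
…ManyTwos go through verbatim; convergence of all words involved follows from that of `V` because the
expansions never CREATE a letter `0` or `4` (`isConvergent_of_forall₂`).

Differences with the unit file: the template is realised by a COUNTER (`XG m W`: the first `m` letters `2`
are the marked ones and get the letter `1`; no marker letter is needed, the letter `0` being a genuine letter
here), the composite expansion `YG m W` is related to it by the multilinearity `expandZ_XG`, its main term is
`(−1)^{|W|} [partnerWord W] + lower` (`main_termG`, lower = letterwise related words with fewer `2`s), and
with `W := partner (reverse V)` the main term reverses to `V`.

Lab check (exact rank, lab of the line, `exp9.py`, full alphabet): the layer with `j` non-`2` letters is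
killed by these generators alone for every `n ≥ 2j+1` tested (`n ≤ 7`) and not for `n = 2j`.
This theorem does not enter the skeleton of line `Sketch` (its lower words may carry MORE letters `0` than
`V`, so it does not respect the `#e₁` filtration); it is the first step of a filtration BY `#2`.

Sources: J. Zhao, C. R. Acad. Sci. Paris 346 (2008), §4 (the involution and its letter table) [Zhao2008];
J. Zhao, Doc. Math. 15 (2010), §2 [Zhao2010]. The inclusion–exclusion is this line's own bookkeeping.
-/

noncomputable section

namespace Summit.KontsevichZagierPeriods.OctahedralSymmetry.OctaSpan.ManyTwos

open Literature.NumberTheory.Transcendental Literature.NumberTheory.Transcendental.LevelFour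

/-! ## G. The σ-inclusion–exclusion over the full alphabet (counter-based templates, no marker letter) -/

/-- The σ-partner of a letter: `0 ↔ 4`, `1 ↔ 3`, `2 ↦ 2` (the letter of `σ^*ω_a` other than `ω_{−1}`).
[cite: Zhao2008, §4] -/
def partner : Fin 5 → Fin 5 := ![4, 3, 2, 1, 0]

/-- `partner` is an involution. [folklore] -/
theorem partner_partner (a : Fin 5) : partner (partner a) = a := by fin_cases a <;> rfl

/-- The partner word (letterwise). [folklore] -/
def partnerWord (W : List (Fin 5)) : List (Fin 5) := W.map partner

/-- `partnerWord` is an involution. [folklore] -/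
theorem partnerWord_partnerWord (W : List (Fin 5)) : partnerWord (partnerWord W) = W := by
  simp [partnerWord, List.map_map, Function.comp_def, partner_partner]

/-- The general template table: a letter `a ≠ 2` expands to `[2] − [a]`, the letter `2` stays. [folklore] -/
def lamG (a : Fin 5) : List (ℤ × Fin 5) := if a = 2 then [(1, 2)] else [(1, 2), (-1, a)]

/-- **The template expansion with a counter**: the first `m` letters `2` are "marked" (they get the letter
`1`), every other letter is expanded by `lamG`. [folklore] -/
def XG : ℕ → List (Fin 5) → List (ℤ × List (Fin 5))
  | _, [] => [(1, [])]
  | m, a :: W =>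
    if a = 2 ∧ 0 < m then (XG (m - 1) W).map fun dV => (dV.1, (1 : Fin 5) :: dV.2)
    else (lamG a).flatMap fun cb => (XG m W).map fun dV => (cb.1 * dV.1, cb.2 :: dV.2)

/-- The composite expansion with a counter (what `expandZ sigmaLetter` does to `XG`): a marked `2` gives
`σ(1) = [3] − [2]`, any other letter `a` gives `compT lamG sigmaLetter a`. [cite: Zhao2008, §4] -/
def YG : ℕ → List (Fin 5) → List (ℤ × List (Fin 5))
  | _, [] => [(1, [])]
  | m, a :: W =>
    if a = 2 ∧ 0 < m then (sigmaLetter 1).flatMap fun cb => (YG (m - 1) W).map fun dV => (cb.1 * dV.1, cb.2 :: dV.2)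
    else (compT lamG sigmaLetter a).flatMap fun cb => (YG m W).map fun dV => (cb.1 * dV.1, cb.2 :: dV.2)

/-- `ofTerms` of a flat-mapped table entry over a term list: `Σ_{(c,b) ∈ E} c • (b :: ·)_* ofTerms L`.
[folklore] -/
theorem ofTerms_flatMap_entry (E : List (ℤ × Fin 5)) (L : List (ℤ × List (Fin 5))) :
    ofTerms (E.flatMap fun cb => L.map fun dV => (cb.1 * dV.1, cb.2 :: dV.2)) =
      (E.map fun cb => cb.1 • (ofTerms L).mapDomain (List.cons cb.2)).sum := by
  induction E with
  | nil => simp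
  | cons cb E ih => rw [List.flatMap_cons, ofTerms_append, ih, ofTerms_map_cons, List.map_cons,
      List.sum_cons]

/-- The multilinearity step for one letter: expanding `Σ_{(c,b)∈E} c • (b :: ·)_* x` under `κ` gives the
composite entry applied to `expandZ κ x`. [folklore] -/
theorem expandZ_entry (κ : Fin 5 → List (ℤ × Fin 5)) (E : List (ℤ × Fin 5)) (x : List (Fin 5) →₀ ℤ) :
    expandZ κ ((E.map fun cb => cb.1 • x.mapDomain (List.cons cb.2)).sum) =
      ((E.flatMap fun cb => (κ cb.2).map fun de => (cb.1 * de.1, de.2)).map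
        fun de => de.1 • (expandZ κ x).mapDomain (List.cons de.2)).sum := by
  have hsf : ∀ (l : List (ℤ × Fin 5)) (f : ℤ × Fin 5 → List (List (Fin 5) →₀ ℤ)),
      (l.flatMap f).sum = (l.map fun y => (f y).sum).sum := by
    intro l f
    induction l with
    | nil => simp
    | cons y l ih => rw [List.flatMap_cons, List.sum_append, List.map_cons, List.sum_cons, ih]
  rw [map_list_sum, List.map_map, List.map_flatMap, hsf]
  congr 1
  refine List.map_congr_left fun cb _ => ?_
  simp only [Function.comp_def, map_zsmul, expandZ_mapDomain_cons, List.smul_sum, List.map_map, mul_smul]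

/-- **Multilinearity with a counter**: `expandZ sigmaLetter (ofTerms (XG m W)) = ofTerms (YG m W)`.
[folklore] -/
theorem expandZ_XG : ∀ (m : ℕ) (W : List (Fin 5)), expandZ sigmaLetter (ofTerms (XG m W)) = ofTerms (YG m W)
  | m, [] => by simp [XG, YG, ofTerms]
  | m, a :: W => by
    rw [XG, YG]
    split_ifs with h
    · have e : (XG (m - 1) W).map (fun dV => (dV.1, (1 : Fin 5) :: dV.2)) =
          [((1 : ℤ), (1 : Fin 5))].flatMap fun cb => (XG (m - 1) W).map fun dV => (cb.1 * dV.1, cb.2 :: dV.2) := by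
        simp
      rw [e, ofTerms_flatMap_entry, expandZ_entry, expandZ_XG (m - 1) W, ofTerms_flatMap_entry]
      simp
    · rw [ofTerms_flatMap_entry, expandZ_entry, expandZ_XG m W, ofTerms_flatMap_entry]
      rfl


/-- The `ℚ`-valued composite expansion with a counter. [folklore] -/
def EQG (m : ℕ) (W : List (Fin 5)) : WordQ := toQ (ofTerms (YG m W))

/-- `toQ` of a flat-mapped table entry, on `WordQ`. [folklore] -/
theorem toQ_ofTerms_flatMap_entry (E : List (ℤ × Fin 5)) (L : List (ℤ × List (Fin 5))) :
    toQ (ofTerms (E.flatMap fun cb => L.map fun dV => (cb.1 * dV.1, cb.2 :: dV.2))) =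
      (E.map fun cb => cb.1 • consQ cb.2 (toQ (ofTerms L))).sum := by
  rw [ofTerms_flatMap_entry, map_list_sum, List.map_map]
  congr 1
  refine List.map_congr_left fun cb _ => ?_
  simp only [Function.comp_apply, map_zsmul, toQ_mapDomain, consQ]

/-- The recursion of `EQG` at a marked letter `2`: `EQG m (2 :: W) = consQ 3 (EQG (m-1) W) − consQ 2 (EQG (m-1) W)`.
[cite: Zhao2008, §4] -/
theorem EQG_cons_marked {m : ℕ} (hm : 0 < m) (W : List (Fin 5)) :
    EQG m (2 :: W) = consQ 3 (EQG (m - 1) W) - consQ 2 (EQG (m - 1) W) := by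
  rw [EQG, YG, if_pos ⟨rfl, hm⟩, toQ_ofTerms_flatMap_entry, ← EQG]
  simp [sigmaLetter, sub_eq_add_neg]

/-- The composite table away from marked letters: `2 ↦ −[2]`, `a ↦ −[2] − [partner a] + [2]` (`a ≠ 2`).
[cite: Zhao2008, §4] -/
theorem compT_lamG_sigma (a : Fin 5) : compT lamG sigmaLetter a =
    if a = 2 then [(-1, 2)] else [(-1, 2), (-1, partner a), (1, 2)] := by
  fin_cases a <;> decide

/-- The recursion of `EQG` at an unmarked letter: `EQG m (a :: W) = −consQ (partner a) (EQG m W)`.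
[cite: Zhao2008, §4] -/
theorem EQG_cons_unmarked {m : ℕ} {a : Fin 5} (h : ¬(a = 2 ∧ 0 < m)) (W : List (Fin 5)) :
    EQG m (a :: W) = -consQ (partner a) (EQG m W) := by
  rw [EQG, YG, if_neg h, toQ_ofTerms_flatMap_entry, ← EQG, compT_lamG_sigma]
  by_cases ha : a = 2
  · subst ha; simp [partner]
  · rw [if_neg ha]; simp only [List.map_cons, List.map_nil, List.sum_cons, List.sum_nil, add_zero,
      neg_smul, one_smul]; abel

/-- `EQG m [] = [[]]`. [folklore] -/
theorem EQG_nil (m : ℕ) : EQG m [] = sym [] := by simp [EQG, YG, ofTerms, sym]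

/-- **The lower span of the composite expansion** relative to a reference word `P` and a bound `c`: words
letterwise related to `P` (each letter: the letter of `P`, or `2`, or `3`) with fewer than `c` letters `2`. [folklore] -/
abbrev LowY (P : List (Fin 5)) (c : ℕ) : Submodule ℚ WordQ :=
  Submodule.span ℚ (sym '' {U | List.Forall₂ (fun u w : Fin 5 => u = w ∨ u = 2 ∨ u = 3) U P ∧ U.count 2 < c})

/-- Prepending related letters maps `LowY P c` into `LowY (p :: P) c'`. [folklore] -/
theorem consQ_mem_LowY {P : List (Fin 5)} {c c' : ℕ} {b p : Fin 5} (hb : b = p ∨ b = 2 ∨ b = 3) (hc : c ≤ c')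
    (hb2 : b = 2 → c < c') {x : WordQ} (hx : x ∈ LowY P c) : consQ b x ∈ LowY (p :: P) c' := by
  have h := Submodule.mem_map_of_mem (f := consQ b) hx
  rw [Submodule.map_span] at h
  refine Submodule.span_mono ?_ h
  rintro _ ⟨_, ⟨V, ⟨h1, h3⟩, rfl⟩, rfl⟩
  refine ⟨b :: V, ⟨List.Forall₂.cons hb h1, ?_⟩, (consQ_sym b V).symm⟩
  by_cases h2b : b = 2
  · subst h2b; rw [List.count_cons_self]; have := hb2 rfl; omega
  · rw [List.count_cons_of_ne h2b]; omega

/-- `partner a = 2 ↔ a = 2`. [folklore] -/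
theorem partner_eq_two_iff (a : Fin 5) : partner a = 2 ↔ a = 2 := by fin_cases a <;> decide

/-- `partnerWord` on a cons. [folklore] -/
@[simp] theorem partnerWord_cons (a : Fin 5) (W : List (Fin 5)) :
    partnerWord (a :: W) = partner a :: partnerWord W := rfl

/-- `partnerWord [] = []`. [folklore] -/
@[simp] theorem partnerWord_nil : partnerWord [] = [] := rfl

/-- `#2 (partnerWord W) = #2 W`. [folklore] -/
theorem count_two_partnerWord (W : List (Fin 5)) : (partnerWord W).count 2 = W.count 2 := by
  induction W with
  | nil => rfl
  | cons a W ih =>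
    rw [partnerWord_cons, List.count_cons, List.count_cons, ih]
    by_cases ha : a = 2
    · subst ha; simp [partner]
    · have : partner a ≠ 2 := fun h => ha ((partner_eq_two_iff a).1 h)
      simp [ha, this]

/-- A word is related to itself letterwise. [folklore] -/
theorem forall₂_relY_refl : ∀ P : List (Fin 5), List.Forall₂ (fun u w : Fin 5 => u = w ∨ u = 2 ∨ u = 3) P P
  | [] => List.Forall₂.nil
  | _ :: P => List.Forall₂.cons (Or.inl rfl) (forall₂_relY_refl P)

/-- **The main term of the composite expansion (general alphabet).** `EQG m W = (−1)^{|W|} [partnerWord W]`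
plus words letterwise related to `partnerWord W` with FEWER letters `2` (at a marked `2` the main choice is
`−[2]`, the other choice `[3]` loses a `2`; unmarked letters expand to the single letter `−[partner a]`).
[folklore] -/
theorem main_termG : ∀ (m : ℕ) (W : List (Fin 5)),
    EQG m W - ((-1 : ℤ) ^ W.length) • sym (partnerWord W) ∈ LowY (partnerWord W) (W.count 2)
  | m, [] => by simp [EQG_nil]
  | m, a :: W => by
    by_cases h : a = 2 ∧ 0 < m
    · obtain ⟨rfl, hm0⟩ := h
      have ih := main_termG (m - 1) W
      set l := EQG (m - 1) W - ((-1 : ℤ) ^ W.length) • sym (partnerWord W) with hl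
      have hE : EQG (m - 1) W = l + ((-1 : ℤ) ^ W.length) • sym (partnerWord W) := by rw [hl]; abel
      have h3 : sym ((3 : Fin 5) :: partnerWord W) ∈ LowY (partnerWord (2 :: W)) ((2 :: W).count 2) := by
        refine Submodule.subset_span ⟨3 :: partnerWord W, ⟨?_, ?_⟩, rfl⟩
        · rw [partnerWord_cons]
          exact List.Forall₂.cons (Or.inr (Or.inr rfl)) (forall₂_relY_refl _)
        · rw [List.count_cons_of_ne (by decide), count_two_partnerWord, List.count_cons_self]; omega
      have hrem : consQ 3 l - consQ 2 l + ((-1 : ℤ) ^ W.length) • sym (3 :: partnerWord W) ∈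
          LowY (partnerWord (2 :: W)) ((2 :: W).count 2) := by
        refine Submodule.add_mem _ (Submodule.sub_mem _ ?_ ?_) (zsmul_mem h3 _)
        · rw [partnerWord_cons]
          exact consQ_mem_LowY (Or.inr (Or.inr rfl)) (by rw [List.count_cons_self]; omega)
            (fun h => absurd h (by decide)) ih
        · rw [partnerWord_cons]
          exact consQ_mem_LowY (Or.inl rfl) (by rw [List.count_cons_self]; omega)
            (fun _ => by rw [List.count_cons_self]; omega) ih
      convert hrem using 1
      rw [EQG_cons_marked hm0, hE, List.length_cons, partnerWord_cons, show partner 2 = 2 from rfl]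
      simp only [map_add, map_zsmul, consQ_sym, pow_succ, mul_neg, mul_one, neg_smul]
      abel
    · have ih := main_termG m W
      set l := EQG m W - ((-1 : ℤ) ^ W.length) • sym (partnerWord W) with hl
      have hE : EQG m W = l + ((-1 : ℤ) ^ W.length) • sym (partnerWord W) := by rw [hl]; abel
      have hrem : -consQ (partner a) l ∈ LowY (partnerWord (a :: W)) ((a :: W).count 2) := by
        rw [partnerWord_cons]
        refine Submodule.neg_mem _ (consQ_mem_LowY (Or.inl rfl) ?_ (fun h2 => ?_) ih)
        · rw [List.count_cons]; split_ifs <;> omega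
        · rw [(partner_eq_two_iff a).1 h2, List.count_cons_self]; omega
      convert hrem using 1
      rw [EQG_cons_unmarked h, hE, List.length_cons, partnerWord_cons]
      simp only [map_add, map_zsmul, pow_succ, mul_neg, mul_one, neg_smul, consQ_sym, neg_add]
      abel

/-- **The words of `XG m W`**: letterwise related to `W` (each letter: the letter of `W`, or `2`, or `1`), and `#2 + min m #2(W) ≤ |W|` (each of the
`min m #2(W)` marked letters is a `1`). [folklore] -/
theorem XG_terms : ∀ (m : ℕ) (W : List (Fin 5)), ∀ t ∈ XG m W,
    List.Forall₂ (fun u w : Fin 5 => u = w ∨ u = 2 ∨ u = 1) t.2 W ∧ t.2.count 2 + min m (W.count 2) ≤ W.length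
  | m, [], t, ht => by
    simp only [XG, List.mem_singleton] at ht
    subst ht; simp
  | m, a :: W, t, ht => by
    rw [XG] at ht
    split_ifs at ht with h
    · obtain ⟨rfl, hm⟩ := h
      obtain ⟨dV, hdV, rfl⟩ := List.mem_map.1 ht
      obtain ⟨h1, h2⟩ := XG_terms (m - 1) W dV hdV
      refine ⟨List.Forall₂.cons (Or.inr (Or.inr rfl)) h1, ?_⟩
      rw [List.count_cons_of_ne (by decide), List.count_cons_self, List.length_cons]
      have : min m (W.count 2 + 1) = min (m - 1) (W.count 2) + 1 := by omega
      omega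
    · rw [List.mem_flatMap] at ht
      obtain ⟨cb, hcb, ht⟩ := ht
      obtain ⟨dV, hdV, rfl⟩ := List.mem_map.1 ht
      obtain ⟨h1, h2⟩ := XG_terms m W dV hdV
      have hcb' : cb.2 = a ∨ cb.2 = 2 := by
        unfold lamG at hcb
        split_ifs at hcb with ha
        · simp at hcb; exact Or.inr (by rw [hcb])
        · simp at hcb; rcases hcb with h' | h' <;> simp [h']
      refine ⟨List.Forall₂.cons (hcb'.elim Or.inl fun e => Or.inr (Or.inl e)) h1, ?_⟩
      simp only [List.count_cons, List.length_cons, beq_iff_eq]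
      by_cases ha : a = 2
      · subst ha
        have hm : m = 0 := by omega
        subst hm; simp at h2 ⊢; split_ifs <;> omega
      · simp only [ha, ite_false, add_zero]; split_ifs <;> omega

/-- A letterwise relation that creates no NEW letter `x` transports "does not start with `x`". [folklore] -/
theorem head?_ne_of_forall₂ {R : Fin 5 → Fin 5 → Prop} {x : Fin 5} (hR : ∀ u w, R u w → u = x → w = x)
    {U W : List (Fin 5)} (h : List.Forall₂ R U W) (hW : W.head? ≠ some x) : U.head? ≠ some x := by
  cases h with
  | nil => simp
  | @cons u w U W huw _ =>
    simp only [List.head?_cons, ne_eq, Option.some.injEq] at hW ⊢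
    exact fun hu => hW (hR u w huw hu)

/-- A letterwise relation that creates no new `0` and no new `4` transports convergence. [folklore] -/
theorem isConvergent_of_forall₂ {R : Fin 5 → Fin 5 → Prop} (h0 : ∀ u w, R u w → u = 0 → w = 0)
    (h4 : ∀ u w, R u w → u = 4 → w = 4) {U W : List (Fin 5)} (h : List.Forall₂ R U W)
    (hW : IsConvergent W) : IsConvergent U := by
  refine ⟨head?_ne_of_forall₂ h0 h hW.1, ?_⟩
  rw [← List.head?_reverse]
  exact head?_ne_of_forall₂ h4 (List.rel_reverse h) (by rw [List.head?_reverse]; exact hW.2)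

/-- The letterwise relation of `XG_terms` creates no new `0`, `4`. [folklore] -/
theorem relX_safe : (∀ u w : Fin 5, (u = w ∨ u = 2 ∨ u = 1) → u = 0 → w = 0) ∧
    (∀ u w : Fin 5, (u = w ∨ u = 2 ∨ u = 1) → u = 4 → w = 4) := by
  constructor <;> rintro u w (rfl | rfl | rfl) h <;> first | exact h | exact absurd h (by decide)

/-- The letterwise relation of `main_termG` creates no new `0`, `4`. [folklore] -/
theorem relY_safe : (∀ u w : Fin 5, (u = w ∨ u = 2 ∨ u = 3) → u = 0 → w = 0) ∧
    (∀ u w : Fin 5, (u = w ∨ u = 2 ∨ u = 3) → u = 4 → w = 4) := by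
  constructor <;> rintro u w (rfl | rfl | rfl) h <;> first | exact h | exact absurd h (by decide)

/-- `partner a = 0 ↔ a = 4` and `partner a = 4 ↔ a = 0`. [folklore] -/
theorem partner_eq_zero_four (a : Fin 5) : (partner a = 0 ↔ a = 4) ∧ (partner a = 4 ↔ a = 0) := by
  fin_cases a <;> decide

/-- The partner of the reversal of a convergent word is convergent. [folklore] -/
theorem isConvergent_partnerWord_reverse {V : List (Fin 5)} (hV : IsConvergent V) :
    IsConvergent (partnerWord V.reverse) := by
  constructor
  · rw [partnerWord, List.head?_map, List.head?_reverse]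
    intro h
    cases hL : V.getLast? with
    | none => rw [hL] at h; exact absurd h (by simp)
    | some a =>
      rw [hL, Option.map_some, Option.some.injEq] at h
      exact hV.2 (by rw [hL, (partner_eq_zero_four a).1.1 h])
  · rw [partnerWord, List.getLast?_map, List.getLast?_reverse]
    intro h
    cases hL : V.head? with
    | none => rw [hL] at h; exact absurd h (by simp)
    | some a =>
      rw [hL, Option.map_some, Option.some.injEq] at h
      exact hV.1 (by rw [hL, (partner_eq_zero_four a).2.1 h])

/-- **The lower span of the general theorem**: convergent words of length `n` with `< c` letters `2`. [folklore] -/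
abbrev LowC (n c : ℕ) : Submodule ℚ WordQ :=
  Submodule.span ℚ (sym '' {V | V.length = n ∧ IsConvergent V ∧ V.count 2 < c})

/-- Reversal maps `LowY P c` into `LowC n c` when `P.reverse` is convergent of length `n`. [folklore] -/
theorem reverse_LowY_le {P : List (Fin 5)} {n c : ℕ} (hP : IsConvergent P.reverse) (hn : P.length = n)
    {x : WordQ} (hx : x ∈ LowY P c) : Finsupp.lmapDomain ℚ ℚ List.reverse x ∈ LowC n c := by
  have h := Submodule.mem_map_of_mem (f := Finsupp.lmapDomain ℚ ℚ List.reverse) hx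
  rw [Submodule.map_span] at h
  refine Submodule.span_mono ?_ h
  rintro _ ⟨_, ⟨U, ⟨h1, h3⟩, rfl⟩, rfl⟩
  refine ⟨U.reverse, ⟨by rw [List.length_reverse, h1.length_eq, hn],
    isConvergent_of_forall₂ relY_safe.1 relY_safe.2 (List.rel_reverse h1) hP, by simpa using h3⟩, ?_⟩
  simp [sym, Finsupp.lmapDomain_apply, Finsupp.mapDomain_single]

end ManyTwos

open Literature.NumberTheory.Transcendental Literature.NumberTheory.Transcendental.LevelFour

open ManyTwos in
/-- **The σ-inclusion–exclusion over the full alphabet (all weights).** Every convergent level-4 word with a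
STRICT MAJORITY of letters `2` (pole `−1`) lies, modulo `rel`, in the span of the convergent words of the same
length with fewer letters `2`; only involution generators (of words with fewer letters `2`) are used. With
`W := partner (reverse V)` and the counter `m := |V| − #2(V) + 1 ≤ #2(V)`, the combination `X := XG m W` of
involution generators has `Σ c • invGen U ∈ rel`, `Σ c • [U]` lower (`XG_terms`), and
`Σ c • sigmaSubst U = ± reverse (EQG m W) = [V] + lower` (`expandZ_XG`, `main_termG`). [folklore] -/
theorem majorityTwos (V : List (Fin 5)) (hV : IsConvergent V) (h : V.length < 2 * V.count 2) :
    sym V ∈ rel ⊔ Submodule.span ℚ (sym '' {V' | V'.length = V.length ∧ IsConvergent V' ∧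
      V'.count 2 < V.count 2}) := by
  set W : List (Fin 5) := partnerWord V.reverse with hWdef
  set n := V.length with hn
  have hWlen : W.length = n := by rw [hWdef, partnerWord, List.length_map, List.length_reverse]
  have hW2 : W.count 2 = V.count 2 := by rw [hWdef, count_two_partnerWord, List.count_reverse]
  have hWconv : IsConvergent W := isConvergent_partnerWord_reverse hV
  have hPW : partnerWord W = V.reverse := by rw [hWdef, partnerWord_partnerWord]
  set m := n - V.count 2 + 1 with hm
  have hmle : m ≤ W.count 2 := by omega
  set X := XG m W with hXdef
  have hXt := XG_terms m W
  have hXconv : ∀ t ∈ X, IsConvergent t.2 := fun t ht =>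
    isConvergent_of_forall₂ relX_safe.1 relX_safe.2 (hXt t ht).1 hWconv
  have hXlen : ∀ t ∈ X, t.2.length = n := fun t ht => (hXt t ht).1.length_eq.trans hWlen
  have hXlow : toQ (ofTerms X) ∈ LowC n (V.count 2) := by
    refine RegularE0.toQ_ofTerms_mem _ X fun t ht => Submodule.subset_span ⟨t.2, ⟨hXlen t ht, hXconv t ht, ?_⟩, rfl⟩
    have := (hXt t ht).2
    rw [min_eq_left hmle, hWlen] at this
    omega
  have hrel : (X.map fun t => t.1 • invGen t.2).sum ∈ rel := sum_invGen_mem_rel X hXconv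
  obtain ⟨l, hl, hEQ⟩ : ∃ l ∈ LowY (partnerWord W) (V.count 2),
      EQG m W = l + ((-1 : ℤ) ^ n) • sym (partnerWord W) := by
    refine ⟨EQG m W - ((-1 : ℤ) ^ W.length) • sym (partnerWord W), ?_, by rw [hWlen]; abel⟩
    have hmain := main_termG m W
    rwa [hW2] at hmain
  have hsig : toQ (sigmaSum X) = sym V + ((-1 : ℤ) ^ n) • Finsupp.lmapDomain ℚ ℚ List.reverse l := by
    rw [sigmaSum_eq n X hXlen, map_zsmul, toQ_mapDomain, hXdef, expandZ_XG, ← EQG, hEQ, map_add, smul_add,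
      map_zsmul, smul_smul, ← pow_add, Even.neg_one_pow ⟨n, rfl⟩, one_smul]
    simp only [Finsupp.lmapDomain_apply, sym, Finsupp.mapDomain_single, hPW, List.reverse_reverse]
    rw [add_comm]
  have hrev : Finsupp.lmapDomain ℚ ℚ List.reverse l ∈ LowC n (V.count 2) :=
    reverse_LowY_le (by rw [hPW, List.reverse_reverse]; exact hV)
      (by rw [partnerWord, List.length_map, hWlen]) hl
  have key : sym V = (toQ (ofTerms X) - (X.map fun t => t.1 • invGen t.2).sum) -
      ((-1 : ℤ) ^ n) • Finsupp.lmapDomain ℚ ℚ List.reverse l := by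
    rw [sum_invGen_eq, hsig]; abel
  rw [key]
  exact Submodule.sub_mem _ (Submodule.sub_mem _ (Submodule.mem_sup_right hXlow)
    (Submodule.mem_sup_left hrel)) (Submodule.mem_sup_right (zsmul_mem hrev _))

namespace ManyTwos
end Summit.KontsevichZagierPeriods.OctahedralSymmetry.OctaSpan.ManyTwos

end
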